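import Literature.NumberTheory.GaloisRepresentations.IdeleClassBarSLayers
import Literature.Algebra.Homology.DiscreteRepSubgroupLayers
import HarnessLib

/-!
# Relative layers of `C̄_S`: for a subgroup `W ≤ G_S`, the layers of `(↥W, Res_W C̄_S)` at the traces `V̄_E ∩ W`
# (`V̄_E = Gal(K_S/E) ≤ W`) are `(H_E ≤ Gal(E/K), Res_{H_E} C_S(E))`, `H_E` the image of `W`:
# `Hⁿ(↥W ⧸ (V̄_E ∩ W), (Res_W C̄_S)^{V̄_E ∩ W}) ≅ Hⁿ(H_E, Res_{H_E} C_S(E))` (Serre I §2.2 Prop. 8; NSW (8.3.8); Harari §4.3 (2)–(3))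

Topic `NumberTheory/GaloisRepresentations`; namespace `Literature.NumberTheory.GaloisRepresentations.IdeleClassBar`.  Sequel to
`IdeleClassBarSLayers.lean` (the top level: `layerSubgroupS S E = V̄_E`, `quotLayerSEquiv`, `layerRepS`, `toLayerS`,
`layerSModuleEquiv : C̄_S^{V̄_E} ≃ₗ[ℤ] C_S(E)`) and to door-c6's `Algebra/Homology/DiscreteRepSubgroupLayers.lean` (the trace
`DiscreteRep.traceOpenNormalSubgroup W V = V ∩ W` of an open normal `V ≤ Γ` on a subgroup `W`, the trace layers
`(Res_W M)^{V ∩ W}`, the vanishing transfer); it is the `C̄_S`-analogue of door-c6's `GalLayerSystemSubgroupLayers.lean` (§7–§8).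
Definitions with bodies (PLUMBING: the restriction `G_S → Gal(E/K)`, the image subgroups, group and module isomorphisms,
the induced isomorphism on group cohomology) and theorems; NO named fact, no instance, no notation, no `sorry`.  Cell `bsd-eis`,
background lane «PT-Ш-S-TC», brick D1-(ii) part 5c (the open-subgroup level indexed by subgroups `W ≤ G_S`, asked for by the
D2-CF consumer, bsd-line-x1-p1-w7 07:56:44Z (a)); written `--supports` crux `GoodLatticeBDPValue` (stmt-BirchSwinnertonDyer-19032).
HONEST FRAMING: layer bookkeeping for door-c4's Tate duality engine at the open subgroups of `G_S` (`invAt`, `extRes`, the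
`Res`-form of the invariant axiom); no duality theorem and no case of BSD is proved here.

THE POINT.  Door-c4's engine (`TateDualityHypothesesAt p (classBarSD K S) inv_S`) asks for class-formation data of
`C̄_S` at every open normal `U ≤ G_S`, i.e. statements about `Extⁿ_{C_{↥U}}(ℤ, Res_U C̄_S) = (DiscreteRep.resD ℤ ↑U).obj (classBarSD K S)`.
By door-c6 these are read on the TRACE layers `Hⁿ(↥U ⧸ (V ∩ U), (Res_U C̄_S)^{V ∩ U})` over the cofinal family `V = V̄_E ≤ U`;
this file identifies such a layer, for `W := ↑U` (any subgroup) and `V̄_E ≤ W`, with the cohomology of the SUBGROUP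
`H_E := {σ|_E : [σ] ∈ W} ≤ Gal(E/K)` with coefficients in Harari's `C_S(E) = classModUnitsRep K E S` RESTRICTED to `H_E` —
the currency of the tree's finite-level theorems at subgroups (`isZero_H1_res_classModUnits`,
`natCard_H2_res_classModUnits`, bsd-line-x1-p1-w4's `map_classModUnits_res_eq_zero_of_…`): `↥W ⧸ (V̄_E ∩ W) ≃* H_E`
(first isomorphism theorem for `w ↦ w|_E`), `(Res_W C̄_S)^{V̄_E ∩ W}` has the same vectors as `C̄_S^{V̄_E} ≃ C_S(E)`, equivariantly.

## What is formalised (`K` a number field, `S : Finset`, `G_S = GaloisGroupUnramifiedOutside K ↑S`, `W : Subgroup G_S`, `E ⊆ K_S`)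

* §1 **`restrictHomS S hE : G_S →* Gal(E/K)`** (`[σ] ↦ σ|_E`; `restrictHomS_mk`, kernel `V̄_E`: `restrictHomS_eq_one_iff`),
  **`subgroupImageS S hE W = W.map (restrictHomS S hE) ≤ Gal(E/K)`** (`H_E`), `toSubgroupImageS` (onto), `ker_toSubgroupImageS`
  (`= V̄_E ∩ W`), **`subgroupImageSEquiv : ↥W ⧸ (V̄_E ∩ W) ≃* H_E`** (+ `coe_subgroupImageSEquiv_mk`).
* §2 **`relLayerRepS S W E := (Res_W C̄_S)^{V̄_E ∩ W}`** (door-c4's layer object for the group `↥W`, verbatim), `relToLayerS`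
  (same vectors as `C̄_S^{V̄_E}`, for `V̄_E ≤ W`), **`relLayerSEquiv : ((Res_W C̄_S)^{V̄_E ∩ W}).V ≃ₗ[ℤ] (Res_{H_E} C_S(E)).V`**
  (+ `_toLayerS` formula, `_ρ_mk`, `relLayerSEquiv_comm`), **`relLayerSCohomologyIso S W hE hEW n :
  Hⁿ(↥W ⧸ (V̄_E ∩ W), (Res_W C̄_S)^{V̄_E ∩ W}) ≅ Hⁿ(H_E, Res_{H_E} C_S(E))`**.
* §3 (transitions, `E ≤ M ⊆ K_S`, `V̄_E ≤ W`): `resHom_restrictHomS`, **`subgroupImageSRes : H_M →* H_E`** (`τ ↦ τ|_E`;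
  `coe_subgroupImageSRes_apply`, `subgroupImageSRes_toSubgroupImageS`, `subtype_comp_subgroupImageSRes`),
  **`relLayerSEquiv_invariantsStepIncl`** (door-c4's `invariantsStepIncl` between the trace layers is `[x]_E ↦ π_M (x_M)`).

## References
* J.-P. Serre, *Galois Cohomology*, Springer (1997), I §2.2 Proposition 8. [SerreGaloisCohomology1997]
* J. Neukirch, A. Schmidt, K. Wingberg, *Cohomology of Number Fields*, 2nd ed. (2008), VIII §3 (8.3.8). [NeukirchSchmidtWingberg2008]
* D. Harari, *Galois Cohomology and Class Field Theory*, Universitext (2020), §4.3 (2)–(3), §17.1 Thm. 17.2. [Harari2020]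
-/

noncomputable section

open NumberField IsDedekindDomain CategoryTheory CategoryTheory.Limits groupCohomology
open Field (absoluteGaloisGroup)
open Literature.NumberTheory.Automorphic Literature.NumberTheory.Automorphic.IdeleClassGroup
open Literature.NumberTheory.NumberFields
open Literature.Algebra.Homology
open Literature.NumberTheory.GaloisRepresentations.LocalWeilDatum (galFixing)
open scoped Classical

namespace Literature.NumberTheory.GaloisRepresentations

namespace IdeleClassBar

variable {K : Type} [Field K] [NumberField K] (S : Finset (HeightOneSpectrum (𝓞 K)))

/-! ## §1. `[σ] ↦ σ|_E : G_S → Gal(E/K)`, the images `H_E` of a subgroup `W ≤ G_S`, and `↥W ⧸ (V̄_E ∩ W) ≃* H_E` -/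

section Restrict

variable {E : GalLayer K} (hE : ramificationSubgroup K (↑S : Set (HeightOneSpectrum (𝓞 K))) ≤ galFixing K E.1)

/-- **`G_S → Gal(E/K)`, `[σ] ↦ σ|_E`** for `E ⊆ K_S` (the projection `G_S → G_S ⧸ V̄_E` followed by `quotLayerSEquiv`).
[cite: SerreGaloisCohomology1997, I §2.2 Proposition 8][cite: NeukirchSchmidtWingberg2008, VIII §3] -/
def restrictHomS : GaloisGroupUnramifiedOutside K (↑S : Set (HeightOneSpectrum (𝓞 K))) →* (E.1 ≃ₐ[K] E.1) :=
  (quotLayerSEquiv S hE).toMonoidHom.comp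
    (QuotientGroup.mk' (layerSubgroupS S E : Subgroup (GaloisGroupUnramifiedOutside K (↑S : Set (HeightOneSpectrum (𝓞 K))))))

/-- Formula: `restrictHomS [σ] = σ|_E`. [cite: SerreGaloisCohomology1997, I §2.2 Proposition 8] -/
@[simp] theorem restrictHomS_mk (σ : absoluteGaloisGroup K) :
    restrictHomS S hE (QuotientGroup.mk σ) = GalLayer.restrictHom E σ :=
  quotLayerSEquiv_mk_mk S hE σ

/-- **The kernel of `[σ] ↦ σ|_E` on `G_S` is `V̄_E`.** [cite: SerreGaloisCohomology1997, I §2.2 Proposition 8] -/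
theorem restrictHomS_eq_one_iff (g : GaloisGroupUnramifiedOutside K (↑S : Set (HeightOneSpectrum (𝓞 K)))) :
    restrictHomS S hE g = 1 ↔ g ∈ (layerSubgroupS S E : Subgroup (GaloisGroupUnramifiedOutside K (↑S : Set (HeightOneSpectrum (𝓞 K))))) := by
  change quotLayerSEquiv S hE (QuotientGroup.mk g) = 1 ↔ _
  rw [MulEquiv.map_eq_one_iff, QuotientGroup.eq_one_iff]

variable (W : Subgroup (GaloisGroupUnramifiedOutside K (↑S : Set (HeightOneSpectrum (𝓞 K)))))

/-- **`H_E = {σ|_E : [σ] ∈ W} ≤ Gal(E/K)`**, the image of a subgroup `W ≤ G_S` in the finite layer `Gal(E/K)` (for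
`W = Gal(K_S/L)`, `L ≤ E`, this is `Gal(E/L)`). [cite: SerreGaloisCohomology1997, I §2.2 Proposition 8] -/
abbrev subgroupImageS : Subgroup (E.1 ≃ₐ[K] E.1) := W.map (restrictHomS S hE)

/-- `w ↦ w|_E : W → H_E`. [cite: SerreGaloisCohomology1997, I §2.2 Proposition 8] -/
def toSubgroupImageS : W →* subgroupImageS S hE W :=
  ((restrictHomS S hE).comp W.subtype).codRestrict _ fun w => Subgroup.mem_map_of_mem (restrictHomS S hE) w.2

/-- Formula. [cite: SerreGaloisCohomology1997, I §2.2 Proposition 8] -/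
@[simp] theorem coe_toSubgroupImageS_apply (w : W) :
    ((toSubgroupImageS S hE W w : subgroupImageS S hE W) : E.1 ≃ₐ[K] E.1) = restrictHomS S hE w := rfl

/-- `w ↦ w|_E : W → H_E` is onto. [cite: SerreGaloisCohomology1997, I §2.2 Proposition 8] -/
theorem toSubgroupImageS_surjective : Function.Surjective (toSubgroupImageS S hE W) := by
  rintro ⟨τ, hτ⟩
  obtain ⟨w, hw, rfl⟩ := Subgroup.mem_map.1 hτ
  exact ⟨⟨w, hw⟩, Subtype.ext rfl⟩

/-- **The kernel of `w ↦ w|_E` on `W` is the trace `V̄_E ∩ W`.** [cite: SerreGaloisCohomology1997, I §2.2 Proposition 8] -/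
theorem ker_toSubgroupImageS :
    (toSubgroupImageS S hE W).ker = (DiscreteRep.traceOpenNormalSubgroup W (layerSubgroupS S E) : Subgroup W) := by
  ext w
  change toSubgroupImageS S hE W w = 1 ↔
    (w : GaloisGroupUnramifiedOutside K (↑S : Set (HeightOneSpectrum (𝓞 K)))) ∈ (layerSubgroupS S E : Subgroup (GaloisGroupUnramifiedOutside K (↑S : Set (HeightOneSpectrum (𝓞 K)))))
  rw [← restrictHomS_eq_one_iff S hE, ← coe_toSubgroupImageS_apply, OneMemClass.coe_eq_one]

/-- **`↥W ⧸ (V̄_E ∩ W) ≃* H_E`** (first isomorphism theorem for `w ↦ w|_E`; Mathlib `QuotientGroup.liftEquiv`).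
[cite: SerreGaloisCohomology1997, I §2.2 Proposition 8] -/
def subgroupImageSEquiv :
    W ⧸ (DiscreteRep.traceOpenNormalSubgroup W (layerSubgroupS S E) : Subgroup W) ≃* subgroupImageS S hE W :=
  QuotientGroup.liftEquiv _ (toSubgroupImageS_surjective S hE W) (ker_toSubgroupImageS S hE W).symm

/-- `subgroupImageSEquiv [w] = w|_E`. [cite: SerreGaloisCohomology1997, I §2.2 Proposition 8] -/
theorem subgroupImageSEquiv_mk (w : W) :
    subgroupImageSEquiv S hE W (QuotientGroup.mk w) = toSubgroupImageS S hE W w := rfl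

/-- `(subgroupImageSEquiv [w] : Gal(E/K)) = w|_E`. [cite: SerreGaloisCohomology1997, I §2.2 Proposition 8] -/
theorem coe_subgroupImageSEquiv_mk (w : W) :
    ((subgroupImageSEquiv S hE W (QuotientGroup.mk w) : subgroupImageS S hE W) : E.1 ≃ₐ[K] E.1) = restrictHomS S hE w :=
  rfl

end Restrict

/-! ## §2. The relative layers `(Res_W C̄_S)^{V̄_E ∩ W}` and their cohomology -/

section RelLayer

variable (W : Subgroup (GaloisGroupUnramifiedOutside K (↑S : Set (HeightOneSpectrum (𝓞 K)))))

/-- **Door-c4's layer object for the group `↥W`: `(Res_W C̄_S)^{V̄_E ∩ W}`** as a representation of `↥W ⧸ (V̄_E ∩ W)`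
(`(invariantsQuotFunctor ℤ (V̄_E ∩ W)).obj ((resD ℤ W).obj (classBarSD K S))`; an abbreviation, so that door-c4's `stepG`,
`inflG`, `LayerColimit.desc`, `extRes_inflG` apply verbatim). [cite: SerreGaloisCohomology1997, I §2.2 Proposition 8] -/
abbrev relLayerRepS (E : GalLayer K) :
    Rep ℤ (W ⧸ (DiscreteRep.traceOpenNormalSubgroup W (layerSubgroupS S E) : Subgroup W)) :=
  (DiscreteRep.invariantsQuotFunctor ℤ (DiscreteRep.traceOpenNormalSubgroup W (layerSubgroupS S E) : Subgroup W)).obj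
    ((DiscreteRep.resD ℤ W).obj (classBarSD K S))

/-- The underlying vector of `[w] • z` in the relative layer is `w • z` in `C̄_S`. [cite: Harari2020, §4.3 Remark 4.24] -/
theorem coe_relLayerRepS_ρ_mk (E : GalLayer K) (w : W) (z : (relLayerRepS S W E).V) :
    (((relLayerRepS S W E).ρ (QuotientGroup.mk w) z).1 : (classBarSRep K S).V) =
      (classBarSRep K S).ρ (w : GaloisGroupUnramifiedOutside K (↑S : Set (HeightOneSpectrum (𝓞 K)))) (z.1 : (classBarSRep K S).V) := rfl

variable {W} {E : GalLayer K} (hE : ramificationSubgroup K (↑S : Set (HeightOneSpectrum (𝓞 K))) ≤ galFixing K E.1)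
  (hEW : (layerSubgroupS S E : Subgroup (GaloisGroupUnramifiedOutside K (↑S : Set (HeightOneSpectrum (𝓞 K))))) ≤ W)

/-- **Same vectors as the layer `C̄_S^{V̄_E}`** (`V̄_E ≤ W`): `(Res_W C̄_S)^{V̄_E ∩ W} ≃ₗ[ℤ] C̄_S^{V̄_E}`, `z ↦ z`.
[cite: SerreGaloisCohomology1997, I §2.2 Proposition 8] -/
def relToLayerS :
    letI := (relLayerRepS S W E).hV2
    letI := (layerRepS S E).hV2
    (relLayerRepS S W E).V ≃ₗ[ℤ] (layerRepS S E).V :=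
  letI := (relLayerRepS S W E).hV2
  letI := (layerRepS S E).hV2
  { toFun := fun z => ⟨z.1, DiscreteRep.coe_traceLayer_mem_invariants W (layerSubgroupS S E) (classBarSD K S) hEW z⟩
    map_add' := fun _ _ => rfl
    map_smul' := fun _ _ => rfl
    invFun := fun z => ⟨z.1, DiscreteRep.mem_invariants_traceLayer W (layerSubgroupS S E) (classBarSD K S) z.1 z.2⟩
    left_inv := fun _ => rfl
    right_inv := fun _ => rfl }

/-- Formula: `relToLayerS` is the identity on underlying vectors. [cite: SerreGaloisCohomology1997, I §2.2 Proposition 8] -/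
@[simp] theorem coe_relToLayerS (z : (relLayerRepS S W E).V) :
    ((relToLayerS S hEW z).1 : (classBarSRep K S).V) = z.1 := rfl

/-- `relToLayerS⁻¹ (toLayerS x)` is `[x]` read in the relative layer (underlying vector `ofLayerS x`).
[cite: SerreGaloisCohomology1997, I §2.2 Proposition 8] -/
theorem coe_relToLayerS_symm_toLayerS (x : layerClass K E) :
    (((relToLayerS S hEW).symm (toLayerS S hE x)).1 : (classBarSRep K S).V) = ofLayerS S hE x := rfl

/-- **The relative layer module: `(Res_W C̄_S)^{V̄_E ∩ W} ≃ₗ[ℤ] C_S(E)`** (`relToLayerS`, then `layerSModuleEquiv`); the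
codomain is written as the module of `Res_{H_E} C_S(E)` (the same type), so that Mathlib's `groupCohomology.mapIso` applies
verbatim. [cite: SerreGaloisCohomology1997, I §2.2 Proposition 8][cite: NeukirchSchmidtWingberg2008, VIII §3 (8.3.8)] -/
def relLayerSEquiv :
    letI := (relLayerRepS S W E).hV2
    letI := (haveI := E.numberField;
      Rep.res (subgroupImageS S hE W).subtype (IdeleCohomology.classModUnitsRep K E.1 S)).hV2
    (relLayerRepS S W E).V ≃ₗ[ℤ]
      (haveI := E.numberField; (Rep.res (subgroupImageS S hE W).subtype (IdeleCohomology.classModUnitsRep K E.1 S)).V) :=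
  haveI := E.numberField
  letI := (relLayerRepS S W E).hV2
  letI := (Rep.res (subgroupImageS S hE W).subtype (IdeleCohomology.classModUnitsRep K E.1 S)).hV2
  letI := (layerRepS S E).hV2
  (relToLayerS S hEW).trans (layerSModuleEquiv S hE)

/-- Formula: `relLayerSEquiv z = layerSModuleEquiv (relToLayerS z)`. [cite: NeukirchSchmidtWingberg2008, VIII §3 (8.3.8)] -/
theorem relLayerSEquiv_apply (z : (relLayerRepS S W E).V) :
    relLayerSEquiv S hE hEW z = layerSModuleEquiv S hE (relToLayerS S hEW z) := rfl

/-- Formula on generators: `relLayerSEquiv [x] = π x` (`[x]` = the vector `ofLayerS x` read in the relative layer).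
[cite: NeukirchSchmidtWingberg2008, VIII §3 (8.3.8)] -/
theorem relLayerSEquiv_symm_toLayerS (x : layerClass K E) :
    relLayerSEquiv S hE hEW ((relToLayerS S hEW).symm (toLayerS S hE x)) =
      (haveI := E.numberField; (cokernel.π (IdeleCohomology.unitsOffToClass (F := K) (E := E.1) S)).hom x) := by
  rw [relLayerSEquiv_apply, LinearEquiv.apply_symm_apply, layerSModuleEquiv_toLayerS]

/-- Every vector of the relative layer is `relToLayerS⁻¹ [x]` for some `x ∈ C_E` (`toLayerS` is onto).
[cite: NeukirchSchmidtWingberg2008, VIII §3 (8.3.7)] -/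
theorem exists_relToLayerS_symm_toLayerS_eq (z : (relLayerRepS S W E).V) :
    ∃ x : layerClass K E, (relToLayerS S hEW).symm (toLayerS S hE x) = z := by
  obtain ⟨x, hx⟩ := toLayerS_surjective S hE (relToLayerS S hEW z)
  exact ⟨x, by rw [hx, LinearEquiv.symm_apply_apply]⟩

/-- `relToLayerS` is equivariant: `[w] • z` read in `C̄_S^{V̄_E}` is `[w] • z` (identity on underlying vectors).
[cite: SerreGaloisCohomology1997, I §2.2 Proposition 8] -/
theorem relToLayerS_ρ_mk (w : W) (z : (relLayerRepS S W E).V) :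
    relToLayerS S hEW ((relLayerRepS S W E).ρ (QuotientGroup.mk w) z) =
      (layerRepS S E).ρ (QuotientGroup.mk (w : GaloisGroupUnramifiedOutside K (↑S : Set (HeightOneSpectrum (𝓞 K))))) (relToLayerS S hEW z) := by
  apply Subtype.ext
  simp only [coe_relToLayerS, coe_relLayerRepS_ρ_mk, coe_layerRepS_ρ_mk]

/-- **Equivariance on generators**: `relLayerSEquiv ([w] • z) = w|_E • relLayerSEquiv z` for `w ∈ W`.
[cite: NeukirchSchmidtWingberg2008, VIII §3 (8.3.8)] -/
theorem relLayerSEquiv_ρ_mk (w : W) (z : (relLayerRepS S W E).V) :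
    relLayerSEquiv S hE hEW ((relLayerRepS S W E).ρ (QuotientGroup.mk w) z) =
      (haveI := E.numberField; (IdeleCohomology.classModUnitsRep K E.1 S).ρ
        (restrictHomS S hE (w : GaloisGroupUnramifiedOutside K (↑S : Set (HeightOneSpectrum (𝓞 K))))) (relLayerSEquiv S hE hEW z)) := by
  haveI := E.numberField
  obtain ⟨x, rfl⟩ := exists_relToLayerS_symm_toLayerS_eq S hE hEW z
  obtain ⟨g, hg⟩ := w
  induction g using QuotientGroup.induction_on with
  | H σ =>
    -- `[⟨[σ], hg⟩] • (relToLayerS⁻¹ [x])` read in `C̄_S^{V̄_E}` is `[[σ]] • [x]`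
    have h1 : relLayerSEquiv S hE hEW ((relLayerRepS S W E).ρ (QuotientGroup.mk ⟨QuotientGroup.mk σ, hg⟩)
        ((relToLayerS S hEW).symm (toLayerS S hE x))) =
        layerSModuleEquiv S hE ((layerRepS S E).ρ (QuotientGroup.mk (QuotientGroup.mk σ)) (toLayerS S hE x)) := by
      rw [relLayerSEquiv_apply, relToLayerS_ρ_mk S hEW ⟨QuotientGroup.mk σ, hg⟩ ((relToLayerS S hEW).symm (toLayerS S hE x)),
        LinearEquiv.apply_symm_apply]
    refine h1.trans ?_
    have h2 : restrictHomS S hE ((⟨QuotientGroup.mk σ, hg⟩ : W) : GaloisGroupUnramifiedOutside K (↑S : Set (HeightOneSpectrum (𝓞 K)))) =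
        GalLayer.restrictHom E σ := restrictHomS_mk S hE σ
    simp only [layerSModuleEquiv_ρ_mk_mk, layerSModuleEquiv_toLayerS, h2]
    exact (congrArg ((IdeleCohomology.classModUnitsRep K E.1 S).ρ (GalLayer.restrictHom E σ))
      (relLayerSEquiv_symm_toLayerS S hE hEW x)).symm

/-- **`relLayerSEquiv` intertwines the `↥W ⧸ (V̄_E ∩ W)`-action with the `H_E`-action on `C_S(E)` along
`subgroupImageSEquiv`** (the form Mathlib's `groupCohomology.mapIso` consumes). [cite: NeukirchSchmidtWingberg2008, VIII §3 (8.3.8)] -/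
theorem relLayerSEquiv_comm (g : W ⧸ (DiscreteRep.traceOpenNormalSubgroup W (layerSubgroupS S E) : Subgroup W)) :
    letI := (relLayerRepS S W E).hV2
    letI := (haveI := E.numberField;
      Rep.res (subgroupImageS S hE W).subtype (IdeleCohomology.classModUnitsRep K E.1 S)).hV2
    (relLayerSEquiv S hE hEW).toLinearMap ∘ₗ (relLayerRepS S W E).ρ g =
      (haveI := E.numberField;
        (Rep.res (subgroupImageS S hE W).subtype (IdeleCohomology.classModUnitsRep K E.1 S)).ρ (subgroupImageSEquiv S hE W g)) ∘ₗ
        (relLayerSEquiv S hE hEW).toLinearMap := by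
  haveI := E.numberField
  letI := (relLayerRepS S W E).hV2
  letI := (IdeleCohomology.classModUnitsRep K E.1 S).hV2
  induction g using QuotientGroup.induction_on with
  | H w =>
    refine LinearMap.ext fun z => ?_
    exact relLayerSEquiv_ρ_mk S hE hEW w z

/-- **The relative layers of `C̄_S` have the cohomology of the subgroups `H_E` with coefficients in `C_S(E)`:
`Hⁿ(↥W ⧸ (V̄_E ∩ W), (Res_W C̄_S)^{V̄_E ∩ W}) ≅ Hⁿ(H_E, Res_{H_E} C_S(E))`** (Mathlib `groupCohomology.mapIso` along
`subgroupImageSEquiv`, `relLayerSEquiv`; `C_S(E) = IdeleCohomology.classModUnitsRep K E S`).  For `W = Gal(K_S/L) = V̄_L`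
(`L ≤ E`) this is `Hⁿ(Gal(E/L), C_S(E))`, the term of NSW (8.3.8) `Hʳ(G_S(L), C_S) = lim→_E Hʳ(Gal(E/L), C_S(E))`.
[cite: SerreGaloisCohomology1997, I §2.2 Proposition 8][cite: NeukirchSchmidtWingberg2008, VIII §3 (8.3.8)] -/
def relLayerSCohomologyIso (n : ℕ) :
    groupCohomology (relLayerRepS S W E) n ≅
      groupCohomology (haveI := E.numberField;
        Rep.res (subgroupImageS S hE W).subtype (IdeleCohomology.classModUnitsRep K E.1 S)) n :=
  haveI := E.numberField
  groupCohomology.mapIso (subgroupImageSEquiv S hE W) (relLayerSEquiv S hE hEW) (relLayerSEquiv_comm S hE hEW) n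

end RelLayer

/-! ## §3. Transitions between relative layers: `res : H_M → H_E` and door-c4's `invariantsStepIncl` -/

section RelTrans

variable {W : Subgroup (GaloisGroupUnramifiedOutside K (↑S : Set (HeightOneSpectrum (𝓞 K))))} {E M : GalLayer K} (h : E ≤ M)
  (hE : ramificationSubgroup K (↑S : Set (HeightOneSpectrum (𝓞 K))) ≤ galFixing K E.1)
  (hM : ramificationSubgroup K (↑S : Set (HeightOneSpectrum (𝓞 K))) ≤ galFixing K M.1)

/-- `(g|_M)|_E = g|_E` on `G_S` (`E ≤ M ⊆ K_S`; door-c5's `GalLayer.resHom`). [cite: SerreGaloisCohomology1997, I §2.2] -/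
theorem resHom_restrictHomS (g : GaloisGroupUnramifiedOutside K (↑S : Set (HeightOneSpectrum (𝓞 K)))) :
    GalLayer.resHom h (restrictHomS S hM g) = restrictHomS S hE g := by
  induction g using QuotientGroup.induction_on with
  | H σ => rw [restrictHomS_mk, restrictHomS_mk, GalLayer.resHom_restrictHom]

variable (W)

/-- **`res : H_M → H_E`, `τ ↦ τ|_E`**, the restriction `Gal(M/K) → Gal(E/K)` on the images of `W` (`E ≤ M`).
[cite: SerreGaloisCohomology1997, I §2.2 Proposition 8] -/
def subgroupImageSRes : subgroupImageS S hM W →* subgroupImageS S hE W :=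
  ((GalLayer.resHom h).comp (subgroupImageS S hM W).subtype).codRestrict _ fun τ => by
    obtain ⟨w, hw, hτ⟩ := Subgroup.mem_map.1 τ.2
    exact Subgroup.mem_map.2 ⟨w, hw, by rw [← resHom_restrictHomS S h hE hM w, hτ]; rfl⟩

/-- Formula: `(subgroupImageSRes τ : Gal(E/K)) = τ|_E`. [cite: SerreGaloisCohomology1997, I §2.2 Proposition 8] -/
@[simp] theorem coe_subgroupImageSRes_apply (τ : subgroupImageS S hM W) :
    ((subgroupImageSRes S W h hE hM τ : subgroupImageS S hE W) : E.1 ≃ₐ[K] E.1) = GalLayer.resHom h (τ : M.1 ≃ₐ[K] M.1) :=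
  rfl

/-- `res (w|_M) = w|_E` for `w ∈ W`. [cite: SerreGaloisCohomology1997, I §2.2 Proposition 8] -/
theorem subgroupImageSRes_toSubgroupImageS (w : W) :
    subgroupImageSRes S W h hE hM (toSubgroupImageS S hM W w) = toSubgroupImageS S hE W w :=
  Subtype.ext (resHom_restrictHomS S h hE hM (w : GaloisGroupUnramifiedOutside K (↑S : Set (HeightOneSpectrum (𝓞 K)))))

/-- `res ∘ incl_{H_M} = incl_{H_E} ∘ res` is literally `GalLayer.resHom h` on underlying automorphisms.
[cite: SerreGaloisCohomology1997, I §2.2 Proposition 8] -/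
theorem subtype_comp_subgroupImageSRes :
    (subgroupImageS S hE W).subtype.comp (subgroupImageSRes S W h hE hM) =
      (GalLayer.resHom h).comp (subgroupImageS S hM W).subtype :=
  MonoidHom.ext fun _ => rfl

variable {W} (hEW : (layerSubgroupS S E : Subgroup (GaloisGroupUnramifiedOutside K (↑S : Set (HeightOneSpectrum (𝓞 K))))) ≤ W)

/-- **Door-c4's inclusion `(Res_W C̄_S)^{V̄_E ∩ W} ⊆ (Res_W C̄_S)^{V̄_M ∩ W}` (`E ≤ M`) sends `[x]_E` to `[x_M]_M`**, read through
the `relLayerSEquiv`s: `π_M (x_M)` — Harari's transition `C_S(E) → C_S(M)` (with `π_transHom_eq_classModUnitsInflHom`: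
bsd-line-x1-p1-w4's `classModUnitsInflHom`). [cite: NeukirchSchmidtWingberg2008, VIII §3 (8.3.9)][cite: Harari2020, §17.4 (17.1)] -/
theorem relLayerSEquiv_invariantsStepIncl (x : layerClass K E) :
    relLayerSEquiv S hM ((layerSubgroupS_anti S h).trans hEW)
        ((DiscreteRep.invariantsStepIncl
          (DiscreteRep.traceOpenNormalSubgroup W (layerSubgroupS S E) : Subgroup W)
          (DiscreteRep.traceOpenNormalSubgroup W (layerSubgroupS S M) : Subgroup W)
          (DiscreteRep.traceOpenNormalSubgroup_mono W (layerSubgroupS_anti S h))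
          ((DiscreteRep.resD ℤ W).obj (classBarSD K S))).hom ((relToLayerS S hEW).symm (toLayerS S hE x))) =
      (haveI := M.numberField; (cokernel.π (IdeleCohomology.unitsOffToClass (F := K) (E := M.1) S)).hom (transHom E M h x)) := by
  have h1 : (DiscreteRep.invariantsStepIncl
      (DiscreteRep.traceOpenNormalSubgroup W (layerSubgroupS S E) : Subgroup W)
      (DiscreteRep.traceOpenNormalSubgroup W (layerSubgroupS S M) : Subgroup W)
      (DiscreteRep.traceOpenNormalSubgroup_mono W (layerSubgroupS_anti S h))
      ((DiscreteRep.resD ℤ W).obj (classBarSD K S))).hom ((relToLayerS S hEW).symm (toLayerS S hE x)) =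
        (relToLayerS S ((layerSubgroupS_anti S h).trans hEW)).symm (toLayerS S hM (transHom E M h x)) :=
    Subtype.ext (ofLayerS_transHom S h hE hM x).symm
  rw [h1]
  exact relLayerSEquiv_symm_toLayerS S hM ((layerSubgroupS_anti S h).trans hEW) (transHom E M h x)

end RelTrans

end IdeleClassBar

end Literature.NumberTheory.GaloisRepresentations

end
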